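import Mathlib.LinearAlgebra.TensorProduct.Basis
import Mathlib.LinearAlgebra.FiniteDimensional.Lemmas
import Mathlib.Algebra.BigOperators.Fin
import HarnessLib

/-!
# COR-CM model layer (row M22 `Fact_algDuality`, input R2 → P): the Rosati TENSOR identity from an
# adjoint pair and a dual pair of families

Cell `pub-hodgecm2` (COR-CM = stage 2 of the Hodge ladder), seat `b13` (row M22 input R2, route Σ, file Σ1).
HONEST FRAMING: pure LINEAR ALGEBRA over a field; no cohomology, no cycles, no Hodge theory.

Let `Q : V → V → W` be bilinear, `b` a basis of `V` indexed by a finite type, `y` a family with the same index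
type which is `Q`-DUAL to `b` (`Q (b a) (y a') = δ_{a a'} • w₀` with `w₀ ≠ 0`), and `(f, g)` an ADJOINT pair of
endomorphisms (`Q (f v) w = Q v (g w)`).  Then

* `linearIndependent_of_dualFamily` / `span_eq_top_of_dualFamily`: `y` is a basis of `V`;
* `sum_tmul_map_eq_sum_tmul_map_of_adjoint`: **`Σ_a f (b a) ⊗ y a = Σ_a b a ⊗ g (y a)`** in `V ⊗ V`.

Proof: read coordinates off `Q` (`Q v (y a') = v^{a'} • w₀`, `Q (b a') w = w^{a'} • w₀`), expand both sums in the
basis `(b a' ⊗ y a)`, and compare coefficients through `w₀ ≠ 0`: `(f b_a)^{a'} • w₀ = Q (f b_a) (y a') =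
Q (b a) (g y a') = (g y a')^{a} • w₀`.

Use (file Σ2 `RosatiTensorFactor`): `V = H¹(A(ℂ); ℚ)` of a CM abelian variety, `W = H^{2g}(A(ℂ); ℚ)`,
`Q_θ(v, w) = θ^{g-1} ⌣ v ⌣ w` the polarization pairing of a rational algebraic Rosati class `θ` (its ADJOINT pairs are
`(ι(x), ι(x̄))`, `x ∈ K` — Shimura 1998 §6.2 Thm. 4 (3), the tree's `Model.var_exists_rosatiTheta_cmAction`), `b` any
basis and `y` the polar family of `θ` (`Q_θ`-dual to `b` up to the factor `g`, the tree's
`Model.smul_cup_polar_cup_cupPow`); the conclusion is the hypothesis `hadj`/`hRos` of the M22 socket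
(`Model.pull_comp_fourierSum_comp_pull_eq_smul`, `Model.map_fourierSum_map_eq_smul_of_adjoint`).

References: G. Shimura, *Abelian Varieties with Complex Multiplication and Modular Functions* (1998) §6.2 Thm. 4;
H. Lange, Ch. Birkenhake, *Complex Abelian Varieties* (1992) §5.1 (Rosati involution), Lemma 1.1.17.
-/

noncomputable section

open scoped TensorProduct

namespace Summit.HodgeConjecture.CorCM.Model

variable {𝕜 : Type*} [Field 𝕜]
variable {V W : Type*} [AddCommGroup V] [Module 𝕜 V] [AddCommGroup W] [Module 𝕜 W]
variable {ι : Type*} [Fintype ι] [DecidableEq ι]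

section DualFamily

variable (Q : V →ₗ[𝕜] V →ₗ[𝕜] W) (b : Module.Basis ι 𝕜 V) (y : ι → V) (w₀ : W)

/-- **Left coordinates from a dual pair**: if `Q (b a) (y a') = δ_{a a'} • w₀`, then `Q v (y a') = v^{a'} • w₀` for
every `v`, `v^{a'}` its coordinate in the basis `b`. [folklore] -/
theorem apply_dualFamily_eq_repr_smul (hQ : ∀ a a', Q (b a) (y a') = if a = a' then w₀ else 0) (v : V) (a' : ι) :
    Q v (y a') = b.repr v a' • w₀ := by
  conv_lhs => rw [← b.sum_repr v]
  rw [LinearMap.map_sum₂]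
  simp_rw [LinearMap.map_smul₂, hQ, smul_ite, smul_zero]
  rw [Finset.sum_ite_eq' Finset.univ a' (fun a ↦ b.repr v a • w₀)]
  simp

/-- **A family dual to a basis is linearly independent** (`w₀ ≠ 0`): apply `Q (b a) ·` to a vanishing combination.
[folklore] -/
theorem linearIndependent_of_dualFamily (hw₀ : w₀ ≠ 0)
    (hQ : ∀ a a', Q (b a) (y a') = if a = a' then w₀ else 0) : LinearIndependent 𝕜 y := by
  rw [Fintype.linearIndependent_iff]
  intro c hc a
  have h : Q (b a) (∑ a', c a' • y a') = c a • w₀ := by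
    rw [map_sum]
    simp_rw [map_smul, hQ, smul_ite, smul_zero]
    rw [Finset.sum_ite_eq Finset.univ a (fun a' ↦ c a' • w₀)]
    simp
  rw [hc, map_zero] at h
  exact (smul_eq_zero.mp h.symm).resolve_right hw₀

/-- **A family dual to a basis spans** (it is linearly independent of the right cardinality). [folklore] -/
theorem span_eq_top_of_dualFamily (hw₀ : w₀ ≠ 0)
    (hQ : ∀ a a', Q (b a) (y a') = if a = a' then w₀ else 0) : Submodule.span 𝕜 (Set.range y) = ⊤ := by
  haveI : FiniteDimensional 𝕜 V := Module.Finite.of_basis b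
  exact (linearIndependent_of_dualFamily Q b y w₀ hw₀ hQ).span_eq_top_of_card_eq_finrank'
    (Module.finrank_eq_card_basis b).symm

/-- **Right coordinates from a dual pair**: if `Q (b a) (y a') = δ_{a a'} • w₀` and `w = Σ_a d a • y a`, then
`Q (b a') w = d a' • w₀`. [folklore] -/
theorem apply_basis_sum_smul_dualFamily (hQ : ∀ a a', Q (b a) (y a') = if a = a' then w₀ else 0)
    (d : ι → 𝕜) (a' : ι) : Q (b a') (∑ a, d a • y a) = d a' • w₀ := by
  rw [map_sum]
  simp_rw [map_smul, hQ, smul_ite, smul_zero]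
  rw [Finset.sum_ite_eq Finset.univ a' (fun a ↦ d a • w₀)]
  simp

end DualFamily

section Adjoint

variable (Q : V →ₗ[𝕜] V →ₗ[𝕜] W) (b : Module.Basis ι 𝕜 V) (y : ι → V) {w₀ : W}

/-- **The Rosati tensor identity from an adjoint pair and a dual pair.**  Let `Q : V → V → W` be bilinear, `b` a
basis of `V`, `y` a family `Q`-dual to `b` (`Q (b a) (y a') = δ_{a a'} • w₀`, `w₀ ≠ 0`), and `f, g` endomorphisms of
`V` with `Q (f v) w = Q v (g w)` for all `v, w`.  Then `Σ_a f (b a) ⊗ y a = Σ_a b a ⊗ g (y a)` in `V ⊗ V`.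
(For `V = H¹(A; ℚ)`, `Q = Q_θ` the polarization pairing of a Rosati class and `(f, g) = (ι(x), ι(x̄))` this is
the tensor form of "the Rosati involution of `θ` induces complex conjugation on `K`".)
[cite: Shimura1998, §6.2 Thm. 4] [cite: LangeBirkenhake1992, §5.1 and Lemma 1.1.17] -/
theorem sum_tmul_map_eq_sum_tmul_map_of_adjoint (hw₀ : w₀ ≠ 0)
    (hQ : ∀ a a', Q (b a) (y a') = if a = a' then w₀ else 0) {f g : V →ₗ[𝕜] V}
    (hadj : ∀ v w, Q (f v) w = Q v (g w)) :
    ∑ a, f (b a) ⊗ₜ[𝕜] y a = ∑ a, b a ⊗ₜ[𝕜] g (y a) := by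
  haveI : FiniteDimensional 𝕜 V := Module.Finite.of_basis b
  -- `y` is a basis
  let yB : Module.Basis ι 𝕜 V := basisOfLinearIndependentOfCardEqFinrank' y
    (linearIndependent_of_dualFamily Q b y w₀ hw₀ hQ) (Module.finrank_eq_card_basis b).symm
  have hyB : ∀ a, yB a = y a := fun a ↦ congrFun (coe_basisOfLinearIndependentOfCardEqFinrank' y _ _) a
  -- coordinates of `g (y a)` in `y`, read off through `Q`
  have hright : ∀ a a', Q (b a') (g (y a)) = yB.repr (g (y a)) a' • w₀ := by
    intro a a'
    conv_lhs => rw [← yB.sum_repr (g (y a))]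
    simp_rw [hyB]
    exact apply_basis_sum_smul_dualFamily Q b y w₀ hQ _ a'
  -- the coefficient identity
  have hcoef : ∀ a a', b.repr (f (b a)) a' = yB.repr (g (y a')) a := by
    intro a a'
    apply smul_left_injective 𝕜 hw₀
    change b.repr (f (b a)) a' • w₀ = yB.repr (g (y a')) a • w₀
    rw [← apply_dualFamily_eq_repr_smul Q b y w₀ hQ, hadj, hright]
  -- expand both sides in the basis `b a' ⊗ y a`
  calc ∑ a, f (b a) ⊗ₜ[𝕜] y a = ∑ a, ∑ a', b.repr (f (b a)) a' • (b a' ⊗ₜ[𝕜] y a) := by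
        refine Finset.sum_congr rfl fun a _ ↦ ?_
        conv_lhs => rw [← b.sum_repr (f (b a))]
        rw [TensorProduct.sum_tmul]
        refine Finset.sum_congr rfl fun a' _ ↦ ?_
        rw [TensorProduct.smul_tmul']
    _ = ∑ a, ∑ a', yB.repr (g (y a')) a • (b a' ⊗ₜ[𝕜] y a) := by
        simp_rw [hcoef]
    _ = ∑ a', ∑ a, yB.repr (g (y a')) a • (b a' ⊗ₜ[𝕜] y a) := Finset.sum_comm
    _ = ∑ a', b a' ⊗ₜ[𝕜] g (y a') := by
        refine Finset.sum_congr rfl fun a' _ ↦ ?_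
        conv_rhs => rw [← yB.sum_repr (g (y a'))]
        rw [TensorProduct.tmul_sum]
        refine Finset.sum_congr rfl fun a _ ↦ ?_
        rw [TensorProduct.tmul_smul, hyB]

/-- **The Rosati tensor identity, `rTensor`/`lTensor` form**: under the hypotheses of
`sum_tmul_map_eq_sum_tmul_map_of_adjoint`, `(f ⊗ 1) T = (1 ⊗ g) T` for `T = Σ_a b a ⊗ y a`. [folklore] -/
theorem rTensor_sum_tmul_eq_lTensor_of_adjoint (hw₀ : w₀ ≠ 0)
    (hQ : ∀ a a', Q (b a) (y a') = if a = a' then w₀ else 0) {f g : V →ₗ[𝕜] V}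
    (hadj : ∀ v w, Q (f v) w = Q v (g w)) :
    (f.rTensor V) (∑ a, b a ⊗ₜ[𝕜] y a) = (g.lTensor V) (∑ a, b a ⊗ₜ[𝕜] y a) := by
  simp only [map_sum, LinearMap.rTensor_tmul, LinearMap.lTensor_tmul]
  exact sum_tmul_map_eq_sum_tmul_map_of_adjoint Q b y hw₀ hQ hadj

end Adjoint

end Summit.HodgeConjecture.CorCM.Model

end
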